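import Mathlib
import Summits.MatrixMultiplication.MatrixMultiplication.Theorems.SubgroupIdentityDesigns.Negative.TransitiveTorus
import Summits.MatrixMultiplication.MatrixMultiplication.Theorems.SubgroupIdentityDesigns.Negative.OrbitPairRight

/-!
# The explicit Singer cycle: `K = {[[x, n y],[y, x]]} ≅ 𝔽_{p²}^×` acts regularly on non-zero vectors

Route `LevelGradedCohnUmans`, crux `SubgroupIdentityDesigns`, the `(m,k) = (2,1)` cell, `p`-free
case.  `TransitiveTorus` / `OrbitPairRight` exclude the level-`1` identity design whenever one
member contains a subgroup `K` acting FREELY and TRANSITIVELY on non-zero vectors and another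
member has a non-trivial element outside `K`.  Here the hypotheses are discharged for the explicit
Singer cycle: with `n` a non-square, `K = {k ∈ GL₂ : k₀₁ = n k₁₀, k₁₁ = k₀₀}` (the multiplications
by `x + y√n` on `𝔽_p[√n] = 𝔽_{p²}`): `singer_free` (anisotropy, as in `NormOneTorus`) and
`singer_transitive` (the explicit `k = M(v) M(a)⁻¹`).  Corollaries
`no_levelOne_design_of_singer₂₁/₃₁/₃₂/₁₂/₁₃/₂₃` — all six placements; every `p` admitting a
non-square `n` (i.e. `p` odd); no TPP, no volume hypothesis.  This settles the cyclic `p`-free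
members `C_ns` (e.g. `p = 5`, class 34, all three positions).  VALUE = THEOREM, NOT summit
progress; the crux item stmt-MatrixMultiplication-14079 is untouched and remains open.
-/

set_option linter.dupNamespace false

noncomputable section

open scoped BigOperators Classical

open Summit.MatrixMultiplication.MatrixMultiplication.Theorems.LieRankDesigns.Negative (GLm Mat)

namespace Summit.MatrixMultiplication.MatrixMultiplication.Theorems.SubgroupIdentityDesigns.Negative

section SingerCycle

variable {p : ℕ} [hp : Fact p.Prime]

/-- The Singer cycle acts freely on non-zero vectors. -/
theorem singer_free {n : ZMod p} (hn : ∀ x : ZMod p, x * x ≠ n) {K : Subgroup (GLm p 2)}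
    (hKshape : ∀ k ∈ K, ((k : GLm p 2) : Mat p 2) 0 1 = n * ((k : GLm p 2) : Mat p 2) 1 0 ∧
      ((k : GLm p 2) : Mat p 2) 1 1 = ((k : GLm p 2) : Mat p 2) 0 0) :
    ∀ a : Fin 2 → ZMod p, a ≠ 0 → ∀ k ∈ K, ∀ k' ∈ K,
      ((k : GLm p 2) : Mat p 2).mulVec a = ((k' : GLm p 2) : Mat p 2).mulVec a → k = k' := by
  intro a ha k hk k' hk' e
  obtain ⟨h01, h11⟩ := hKshape k hk
  obtain ⟨h01', h11'⟩ := hKshape k' hk'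
  have e0 := congr_fun e 0
  have e1 := congr_fun e 1
  rw [mulVec_two_apply_zero, mulVec_two_apply_zero] at e0
  rw [mulVec_two_apply_one, mulVec_two_apply_one] at e1
  obtain ⟨hX, hY⟩ := shape_kernel hn ha
    (X := ((k : GLm p 2) : Mat p 2) 0 0 - ((k' : GLm p 2) : Mat p 2) 0 0)
    (Y := ((k : GLm p 2) : Mat p 2) 1 0 - ((k' : GLm p 2) : Mat p 2) 1 0)
    (by linear_combination e0 - a 1 * h01 + a 1 * h01')
    (by linear_combination e1 - a 1 * h11 + a 1 * h11')
  have hX' := sub_eq_zero.mp hX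
  have hY' := sub_eq_zero.mp hY
  exact gl2_ext hX' (by rw [h01, h01', hY']) hY' (by rw [h11, h11', hX'])

/-- `Q(a) = a₀² - n a₁² ≠ 0` for `a ≠ 0` (anisotropy). -/
theorem normForm_ne_zero {n : ZMod p} (hn : ∀ x : ZMod p, x * x ≠ n) {a : Fin 2 → ZMod p}
    (ha : a ≠ 0) : a 0 * a 0 - n * (a 1 * a 1) ≠ 0 := by
  intro hQ
  obtain ⟨h0, h1⟩ := anisotropic_of_nonsquare hn (sub_eq_zero.mp hQ)
  apply ha
  funext i
  fin_cases i
  · simpa using h0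
  · simpa using h1

/-- The Singer cycle acts transitively on non-zero vectors: `k = M(v) M(a)⁻¹` maps `a` to `v`. -/
theorem singer_transitive {n : ZMod p} (hn : ∀ x : ZMod p, x * x ≠ n) {K : Subgroup (GLm p 2)}
    (hKall : ∀ k : GLm p 2, (k : Mat p 2) 0 1 = n * (k : Mat p 2) 1 0 →
      (k : Mat p 2) 1 1 = (k : Mat p 2) 0 0 → k ∈ K) :
    ∀ a : Fin 2 → ZMod p, a ≠ 0 → ∀ v : Fin 2 → ZMod p, v ≠ 0 → ∃ k ∈ K,
      ((k : GLm p 2) : Mat p 2).mulVec a = v := by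
  intro a ha v hv
  have hQa := normForm_ne_zero hn ha
  have hQv := normForm_ne_zero hn hv
  have hB : (v 0 * a 0 - n * v 1 * a 1) * (v 0 * a 0 - n * v 1 * a 1) -
      n * ((v 1 * a 0 - v 0 * a 1) * (v 1 * a 0 - v 0 * a 1)) =
      (v 0 * v 0 - n * (v 1 * v 1)) * (a 0 * a 0 - n * (a 1 * a 1)) := by ring
  have key : ∀ N₁ N₂ Q P : ZMod p, Q ≠ 0 → P ≠ 0 → N₁ * N₁ - n * (N₂ * N₂) = P * Q →
      N₁ / Q * (N₁ / Q) - n * (N₂ / Q) * (N₂ / Q) ≠ 0 := by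
    intro N₁ N₂ Q P hQ hP hB
    rw [mul_assoc, div_mul_div_comm, div_mul_div_comm, ← mul_div_assoc, ← sub_div, hB]
    exact div_ne_zero (mul_ne_zero hP hQ) (mul_ne_zero hQ hQ)
  have hdet := key (v 0 * a 0 - n * v 1 * a 1) (v 1 * a 0 - v 0 * a 1)
    (a 0 * a 0 - n * (a 1 * a 1)) (v 0 * v 0 - n * (v 1 * v 1)) hQa hQv hB
  obtain ⟨k, h00, h01, h10, h11⟩ := exists_gl2
    ((v 0 * a 0 - n * v 1 * a 1) / (a 0 * a 0 - n * (a 1 * a 1)))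
    (n * ((v 1 * a 0 - v 0 * a 1) / (a 0 * a 0 - n * (a 1 * a 1))))
    ((v 1 * a 0 - v 0 * a 1) / (a 0 * a 0 - n * (a 1 * a 1)))
    ((v 0 * a 0 - n * v 1 * a 1) / (a 0 * a 0 - n * (a 1 * a 1))) hdet
  refine ⟨k, hKall k (by rw [h01, h10]) (by rw [h11, h00]), ?_⟩
  funext i
  fin_cases i
  · simp only [Fin.zero_eta, Fin.isValue]
    rw [mulVec_two_apply_zero, h00, h01]
    rw [show ∀ N₁ N₂ : ZMod p, N₁ / (a 0 * a 0 - n * (a 1 * a 1)) * a 0 +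
        n * (N₂ / (a 0 * a 0 - n * (a 1 * a 1))) * a 1 =
        (N₁ * a 0 + n * N₂ * a 1) / (a 0 * a 0 - n * (a 1 * a 1)) from fun _ _ => by ring]
    rw [div_eq_iff hQa]
    ring
  · simp only [Fin.mk_one, Fin.isValue]
    rw [mulVec_two_apply_one, h10, h11]
    rw [show ∀ N₁ N₂ : ZMod p, N₂ / (a 0 * a 0 - n * (a 1 * a 1)) * a 0 +
        N₁ / (a 0 * a 0 - n * (a 1 * a 1)) * a 1 =
        (N₂ * a 0 + N₁ * a 1) / (a 0 * a 0 - n * (a 1 * a 1)) from fun _ _ => by ring]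
    rw [div_eq_iff hQa]
    ring

end SingerCycle

section SingerPlacements

variable {p : ℕ} [hp : Fact p.Prime]

/-- **Singer cycle in `H₂`, a non-trivial element of `H₁` outside it ⇒ no level-one
identity design** (all `p` with a non-square `n`; no TPP). -/
theorem no_levelOne_design_of_singer₂₁ {H₁ H₂ H₃ : Subgroup (GLm p 2)}
    (n : ZMod p) (hn : ∀ x : ZMod p, x * x ≠ n) (K : Subgroup (GLm p 2))
    (hKshape : ∀ k ∈ K, ((k : GLm p 2) : Mat p 2) 0 1 = n * ((k : GLm p 2) : Mat p 2) 1 0 ∧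
      ((k : GLm p 2) : Mat p 2) 1 1 = ((k : GLm p 2) : Mat p 2) 0 0)
    (hKall : ∀ k : GLm p 2, (k : Mat p 2) 0 1 = n * (k : Mat p 2) 1 0 →
      (k : Mat p 2) 1 1 = (k : Mat p 2) 0 0 → k ∈ K)
    (hKH : K ≤ H₂) (k₀ : GLm p 2) (hk₀ : k₀ ∈ H₁) (hk₀K : k₀ ∉ K) :
    ¬ ∃ c : Mat p 2 → ℂ, (∀ M, 1 < M.rank → c M = 0) ∧
      (∑ M, c M * ZMod.stdAddChar (Matrix.trace (M * ((1 : GLm p 2) : Mat p 2)))) = 1 ∧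
      ∀ a ∈ H₁, ∀ b ∈ H₂, ∀ g ∈ H₃, a * b * g ≠ 1 →
        (∑ M, c M *
          ZMod.stdAddChar (Matrix.trace (M * ((a * b * g : GLm p 2) : Mat p 2)))) = 0 :=
  no_levelOne_design_of_transitive₂₁ K hKH k₀ hk₀ hk₀K (singer_free hn hKshape)
    (singer_transitive hn hKall)

/-- **Singer cycle in `H₃`, a non-trivial element of `H₁` outside it ⇒ no level-one
identity design** (all `p` with a non-square `n`; no TPP). -/
theorem no_levelOne_design_of_singer₃₁ {H₁ H₂ H₃ : Subgroup (GLm p 2)}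
    (n : ZMod p) (hn : ∀ x : ZMod p, x * x ≠ n) (K : Subgroup (GLm p 2))
    (hKshape : ∀ k ∈ K, ((k : GLm p 2) : Mat p 2) 0 1 = n * ((k : GLm p 2) : Mat p 2) 1 0 ∧
      ((k : GLm p 2) : Mat p 2) 1 1 = ((k : GLm p 2) : Mat p 2) 0 0)
    (hKall : ∀ k : GLm p 2, (k : Mat p 2) 0 1 = n * (k : Mat p 2) 1 0 →
      (k : Mat p 2) 1 1 = (k : Mat p 2) 0 0 → k ∈ K)
    (hKH : K ≤ H₃) (k₀ : GLm p 2) (hk₀ : k₀ ∈ H₁) (hk₀K : k₀ ∉ K) :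
    ¬ ∃ c : Mat p 2 → ℂ, (∀ M, 1 < M.rank → c M = 0) ∧
      (∑ M, c M * ZMod.stdAddChar (Matrix.trace (M * ((1 : GLm p 2) : Mat p 2)))) = 1 ∧
      ∀ a ∈ H₁, ∀ b ∈ H₂, ∀ g ∈ H₃, a * b * g ≠ 1 →
        (∑ M, c M *
          ZMod.stdAddChar (Matrix.trace (M * ((a * b * g : GLm p 2) : Mat p 2)))) = 0 :=
  no_levelOne_design_of_transitive₃₁ K hKH k₀ hk₀ hk₀K (singer_free hn hKshape)
    (singer_transitive hn hKall)

/-- **Singer cycle in `H₃`, a non-trivial element of `H₂` outside it ⇒ no level-one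
identity design** (all `p` with a non-square `n`; no TPP). -/
theorem no_levelOne_design_of_singer₃₂ {H₁ H₂ H₃ : Subgroup (GLm p 2)}
    (n : ZMod p) (hn : ∀ x : ZMod p, x * x ≠ n) (K : Subgroup (GLm p 2))
    (hKshape : ∀ k ∈ K, ((k : GLm p 2) : Mat p 2) 0 1 = n * ((k : GLm p 2) : Mat p 2) 1 0 ∧
      ((k : GLm p 2) : Mat p 2) 1 1 = ((k : GLm p 2) : Mat p 2) 0 0)
    (hKall : ∀ k : GLm p 2, (k : Mat p 2) 0 1 = n * (k : Mat p 2) 1 0 →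
      (k : Mat p 2) 1 1 = (k : Mat p 2) 0 0 → k ∈ K)
    (hKH : K ≤ H₃) (k₀ : GLm p 2) (hk₀ : k₀ ∈ H₂) (hk₀K : k₀ ∉ K) :
    ¬ ∃ c : Mat p 2 → ℂ, (∀ M, 1 < M.rank → c M = 0) ∧
      (∑ M, c M * ZMod.stdAddChar (Matrix.trace (M * ((1 : GLm p 2) : Mat p 2)))) = 1 ∧
      ∀ a ∈ H₁, ∀ b ∈ H₂, ∀ g ∈ H₃, a * b * g ≠ 1 →
        (∑ M, c M *
          ZMod.stdAddChar (Matrix.trace (M * ((a * b * g : GLm p 2) : Mat p 2)))) = 0 :=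
  no_levelOne_design_of_transitive₃₂ K hKH k₀ hk₀ hk₀K (singer_free hn hKshape)
    (singer_transitive hn hKall)

/-- **Singer cycle in `H₁`, a non-trivial element of `H₂` outside it ⇒ no level-one
identity design** (all `p` with a non-square `n`; no TPP). -/
theorem no_levelOne_design_of_singer₁₂ {H₁ H₂ H₃ : Subgroup (GLm p 2)}
    (n : ZMod p) (hn : ∀ x : ZMod p, x * x ≠ n) (K : Subgroup (GLm p 2))
    (hKshape : ∀ k ∈ K, ((k : GLm p 2) : Mat p 2) 0 1 = n * ((k : GLm p 2) : Mat p 2) 1 0 ∧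
      ((k : GLm p 2) : Mat p 2) 1 1 = ((k : GLm p 2) : Mat p 2) 0 0)
    (hKall : ∀ k : GLm p 2, (k : Mat p 2) 0 1 = n * (k : Mat p 2) 1 0 →
      (k : Mat p 2) 1 1 = (k : Mat p 2) 0 0 → k ∈ K)
    (hKH : K ≤ H₁) (k₀ : GLm p 2) (hk₀ : k₀ ∈ H₂) (hk₀K : k₀ ∉ K) :
    ¬ ∃ c : Mat p 2 → ℂ, (∀ M, 1 < M.rank → c M = 0) ∧
      (∑ M, c M * ZMod.stdAddChar (Matrix.trace (M * ((1 : GLm p 2) : Mat p 2)))) = 1 ∧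
      ∀ a ∈ H₁, ∀ b ∈ H₂, ∀ g ∈ H₃, a * b * g ≠ 1 →
        (∑ M, c M *
          ZMod.stdAddChar (Matrix.trace (M * ((a * b * g : GLm p 2) : Mat p 2)))) = 0 :=
  no_levelOne_design_of_transitive₁₂ K hKH k₀ hk₀ hk₀K (singer_free hn hKshape)
    (singer_transitive hn hKall)

/-- **Singer cycle in `H₁`, a non-trivial element of `H₃` outside it ⇒ no level-one
identity design** (all `p` with a non-square `n`; no TPP). -/
theorem no_levelOne_design_of_singer₁₃ {H₁ H₂ H₃ : Subgroup (GLm p 2)}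
    (n : ZMod p) (hn : ∀ x : ZMod p, x * x ≠ n) (K : Subgroup (GLm p 2))
    (hKshape : ∀ k ∈ K, ((k : GLm p 2) : Mat p 2) 0 1 = n * ((k : GLm p 2) : Mat p 2) 1 0 ∧
      ((k : GLm p 2) : Mat p 2) 1 1 = ((k : GLm p 2) : Mat p 2) 0 0)
    (hKall : ∀ k : GLm p 2, (k : Mat p 2) 0 1 = n * (k : Mat p 2) 1 0 →
      (k : Mat p 2) 1 1 = (k : Mat p 2) 0 0 → k ∈ K)
    (hKH : K ≤ H₁) (k₀ : GLm p 2) (hk₀ : k₀ ∈ H₃) (hk₀K : k₀ ∉ K) :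
    ¬ ∃ c : Mat p 2 → ℂ, (∀ M, 1 < M.rank → c M = 0) ∧
      (∑ M, c M * ZMod.stdAddChar (Matrix.trace (M * ((1 : GLm p 2) : Mat p 2)))) = 1 ∧
      ∀ a ∈ H₁, ∀ b ∈ H₂, ∀ g ∈ H₃, a * b * g ≠ 1 →
        (∑ M, c M *
          ZMod.stdAddChar (Matrix.trace (M * ((a * b * g : GLm p 2) : Mat p 2)))) = 0 :=
  no_levelOne_design_of_transitive₁₃ K hKH k₀ hk₀ hk₀K (singer_free hn hKshape)
    (singer_transitive hn hKall)

/-- **Singer cycle in `H₂`, a non-trivial element of `H₃` outside it ⇒ no level-one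
identity design** (all `p` with a non-square `n`; no TPP). -/
theorem no_levelOne_design_of_singer₂₃ {H₁ H₂ H₃ : Subgroup (GLm p 2)}
    (n : ZMod p) (hn : ∀ x : ZMod p, x * x ≠ n) (K : Subgroup (GLm p 2))
    (hKshape : ∀ k ∈ K, ((k : GLm p 2) : Mat p 2) 0 1 = n * ((k : GLm p 2) : Mat p 2) 1 0 ∧
      ((k : GLm p 2) : Mat p 2) 1 1 = ((k : GLm p 2) : Mat p 2) 0 0)
    (hKall : ∀ k : GLm p 2, (k : Mat p 2) 0 1 = n * (k : Mat p 2) 1 0 →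
      (k : Mat p 2) 1 1 = (k : Mat p 2) 0 0 → k ∈ K)
    (hKH : K ≤ H₂) (k₀ : GLm p 2) (hk₀ : k₀ ∈ H₃) (hk₀K : k₀ ∉ K) :
    ¬ ∃ c : Mat p 2 → ℂ, (∀ M, 1 < M.rank → c M = 0) ∧
      (∑ M, c M * ZMod.stdAddChar (Matrix.trace (M * ((1 : GLm p 2) : Mat p 2)))) = 1 ∧
      ∀ a ∈ H₁, ∀ b ∈ H₂, ∀ g ∈ H₃, a * b * g ≠ 1 →
        (∑ M, c M *
          ZMod.stdAddChar (Matrix.trace (M * ((a * b * g : GLm p 2) : Mat p 2)))) = 0 :=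
  no_levelOne_design_of_transitive₂₃ K hKH k₀ hk₀ hk₀K (singer_free hn hKshape)
    (singer_transitive hn hKall)

end SingerPlacements

end Summit.MatrixMultiplication.MatrixMultiplication.Theorems.SubgroupIdentityDesigns.Negative

end
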